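import Summits.QuantumFields.BalabanUV.Beta.GAN24.MonotoneCovLimit
import Summits.QuantumFields.BalabanUV.Beta.GAN24.MonotoneTorusHodge
import Literature.MathematicalPhysics.QuantumFieldTheory.Balaban1983to89.Beta.Ineq167OperatorUpper

/-!
# Beta / GAN24 / MonotoneTorusEffectiveLimit — THE LIMIT OBJECT OF ROAD P4's TORUS AVATAR IDENTIFIED: `Δ_∞ := lim_k Δ_{Lc^k}` exists (monotone and
# bounded by the printed (1.67) upper bound), every `Δ_k` and `Δ_∞` have the SAME constrained zero modes (the closed 1-forms), and the plaquette
# covariances `plaqCov R k` converge, entrywise, to the `R`-constrained plaquette covariance of `2Δ_∞` — SKELETON-P4 node N6's «continuum object» typed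
# (gan24-p4 gen 4; BINDER-OWNERS row G-an2-4 ∕ (CONV-C), ALTERNATIVE DISCHARGE «rate OR monotonicity»; NOT IN PRINT — our proof attempt)

HONEST FRAMING (page 1 of everything the β sub-cell writes): discharging `BetaPertH` makes Bałaban's UV stability UNCONDITIONAL — a
real constructive-QFT result; it is NOT the continuum limit and NOT the Clay problem.  HONEST DEPENDENCY (cell reorg 2026-08-19, verbatim):
«continuum YM on T⁴ ⇐ BetaPertH ∧ nine spine estimates (0/9 proved); BetaPertH ⇐ (D1) ∧ (D4) ∧ CAP+tail; G-an2-4 gates asym, D1 and NE2/3/4.»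
HONEST LABEL: «not in print; our proof attempt; alternative discharge of the G-an2-4 row (rate OR monotonicity)»; 0 wall binders instantiated.
ABSOLUTE RULE honoured: NOTHING is cited here as a fact.  Tree inputs BY NAME: `Beta.Ineq167OperatorUpper.ineq167_upper` (the printed (1.67) upper half
`⟨B,Δ_kB⟩ ≤ γ₁⟨∂₁B,∂₁B⟩` for the typed `DelK`, kernel-proved there; the constant `γ₁ = (π²/4)^{d+2}` is THAT TREE MODULE's — [B5] prints no value for
the (1.67) constant; v1.2 DOCFIX of the v1 word «theirs», conceded to the cross-read C-gan24leaf20-g19-1), `Beta.Ineq167Operator.d1Sq_eq_Fs`,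
`B5AverageCurlStokes.Fs_eq_mul_plaq`, `Beta.BlockEffectiveAction.DelK_mulVec_grad`∕`DelK_mulVec_const` (gradients and constants are in `ker Δ_k`), gen 3's
`MonotoneTorusHodge.exists_potential_of_plaq_eq_zero` (discrete Poincaré lemma), gen 3∕4's `MonotoneTorusPlaquette`∕`MonotoneTorusEffective`, and gen 4's
abstract `MonotoneCovLimit.readOut_critCov_tendsto`.  [folklore] glue only.

## WHAT IS PROVED (every `d`, `Lc ≥ 1`, read-out torus `Tor M`, constraint matrix `R`)
* §1 `d1Sq_eq_half_curlEnergy`, **`effAction_le_curlBound`**: `effAction k ≤ γ₁ • curlMatᴴcurlMat` for every `k` ((1.67) upper ×2, since `effAction k = 2Δ_k`).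
* §2 **`effInf`** := the entrywise limit of `effAction k` (`exists_effInf` ⇐ `MonotoneCovLimit.exists_tendsto_of_mono_bounded`); `effInf_tendsto`, `effInf_posSemidef`,
  `effAction_le_effInf`; **`DelK_tendsto_half_effInf`**: `Δ_{Lc^k} → ½·effInf =: Δ_∞` entrywise.
* §3 **`effAction_ker_stable`**: `R z = 0 ∧ effAction 0 z = 0 ⟹ effAction k z = 0` for EVERY `k` — the constrained zero modes are the closed 1-forms at every
  level (curl-free ⟹ gradient + constant by the discrete Poincaré lemma ⟹ in `ker Δ_k` by `DelK_mulVec_grad`∕`DelK_mulVec_const`).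
* §4 **`plaqCov_tendsto_effInf : plaqCov R k a b → (curlMat M · critCov effInf R · (curlMat M)ᴴ) a b`** — the refinement limit of the plaquette covariances
  (gen 3 `exists_plaqCov_limit`) IS the `R`-constrained plaquette covariance of the limit block action `2Δ_∞`; hence the one-datum band of road P4 is centred
  at an identified object (`plaqCov_sub_effInf_le`: `‖(plaqCov R j − curlMat·critCov effInf R·curlMatᴴ) a b‖ ≤ η₀` for `j ≥ k₀` from ONE trace datum).
* §5 (v1.1) **`formDk_tendsto_half_effInf`**: `formDk (Lc^k) M B → ½·re⟨B, effInf B⟩` — the form of `Δ_∞` IS the limit of the printed (1.66) forms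
  (= the tree's `F_∞` of `B5ActionRate166.formDk_limit`, `half_effInf_quad_eq_formDk_limit`).
* §6 (v1.2) `effInf_ker_stable`, **`effInf_ker_iff : effInf z = 0 ↔ effAction 0 z = 0`** — the title's «every `Δ_k` AND `Δ_∞` have the same zero modes»
  as a declaration (NIT of the cross-read C-gan24leaf20-g19-1); `effAction_ker_iff : effAction k z = 0 ↔ effAction 0 z = 0`.
WHAT THIS IS NOT: no rate (the tree's `formDk_limit` rate `L^{−2k}` is not used), no closed formula for `Δ_∞`; torus, `U = 1`;
NOT (CONV-C), NOT BetaPertH, NOT continuum, NOT Clay.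
-/

noncomputable section

namespace Summit.QuantumFields.BalabanUV.Beta.GAN24.MonotoneTorusEffectiveLimit

open Matrix Filter Topology
open scoped BigOperators ComplexOrder
open Literature.MathematicalPhysics.QuantumFieldTheory.Balaban1983to89
open Literature.MathematicalPhysics.QuantumFieldTheory.Balaban1983to89.B5Prop11Plancherel (Tor fine unitVec)
open Literature.MathematicalPhysics.QuantumFieldTheory.Balaban1983to89.B5Action121 (GradOp GradOp_mulVec sdiff_mulVec Fs)
open Literature.MathematicalPhysics.QuantumFieldTheory.Balaban1983to89.B5AverageCurlStokes (plaq Fs_eq_mul_plaq)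
open Literature.MathematicalPhysics.QuantumFieldTheory.Balaban1983to89.B5Bounds167Lattice (d1Sq)
open Literature.MathematicalPhysics.QuantumFieldTheory.Balaban1983to89.Beta.Ineq167Operator (d1Sq_eq_Fs)
open Literature.MathematicalPhysics.QuantumFieldTheory.Balaban1983to89.Beta.Ineq167OperatorUpper (gamma1 ineq167_upper)
open Literature.MathematicalPhysics.QuantumFieldTheory.Balaban1983to89.Beta.BlockEffectiveAction (DelK DelK_mulVec_grad DelK_mulVec_const)
open Summit.QuantumFields.BalabanUV.Beta.GAN24.MonotoneCritical (critCov critCov_isHermitian)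
open Summit.QuantumFields.BalabanUV.Beta.GAN24.MonotoneLoewner (posSemidef_of_isHermitian_re_nonneg)
open Summit.QuantumFields.BalabanUV.Beta.GAN24.MonotoneTorusTower (curlMat curlMat_mulVec curlEnergy quad_curlMat)
open Summit.QuantumFields.BalabanUV.Beta.GAN24.MonotoneTorusPlaquette (plaqCov)
open Summit.QuantumFields.BalabanUV.Beta.GAN24.MonotoneTorusHodge (exists_potential_of_plaq_eq_zero)
open Summit.QuantumFields.BalabanUV.Beta.GAN24.MonotoneTorusEffective (effAction effAction_isHermitian effAction_posSemidef effAction_step_mono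
  effAction_eq_two_smul_DelK effAction_quad_eq_two_DelK one_le_pow_Lc curlMat_of_effAction_ker plaqCov_eq_critCov_effAction)
open Summit.QuantumFields.BalabanUV.Beta.GAN24.MonotoneCovLimit (exists_tendsto_of_mono_bounded posSemidef_of_tendsto posSemidef_limit_sub
  readOut_critCov_tendsto)
open Summit.QuantumFields.BalabanUV.Beta.GAN24.MonotoneLimit (norm_sub_lim_apply_le_of_steps)
open Summit.QuantumFields.BalabanUV.Beta.GAN24.MonotoneTorusPlaquette (plaqCov_antitone_step)

variable {d : ℕ} (Lc : ℕ) [NeZero Lc] (M : Fin d → ℕ) [hM : ∀ μ, NeZero (M μ)]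

/-! ## §1 The printed (1.67) upper bound as a Loewner bound on the effective actions -/

omit [NeZero Lc] in
/-- `⟨∂₁B,∂₁B⟩ = ½ · curlEnergy B` (`d1Sq` sums `|F¹|² = |plaq|²` over ordered pairs with a `½`). [folklore] -/
theorem d1Sq_eq_half_curlEnergy (B : Tor M × Fin d → ℂ) : d1Sq M B = 1 / 2 * curlEnergy M B := by
  rw [d1Sq_eq_Fs, curlEnergy]
  simp_rw [Fs_eq_mul_plaq, one_mul]

/-- The `k`-independent bound `γ₁ • curlMatᴴ curlMat` (`γ₁ = (π²/4)^{d+2}`, the tree's (1.67) upper constant). [folklore] -/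
def curlBound : Matrix (Tor M × Fin d) (Tor M × Fin d) ℂ := ((gamma1 d : ℝ) : ℂ) • ((curlMat M)ᴴ * curlMat M)

omit [NeZero Lc] in
/-- `curlBound` is Hermitian. [folklore] -/
theorem curlBound_isHermitian : (curlBound M).IsHermitian :=
  (Matrix.isHermitian_conjTranspose_mul_self _).smul (by rw [IsSelfAdjoint, Complex.star_def, Complex.conj_ofReal])

/-- **`effAction k ≤ γ₁ • curlMatᴴ curlMat`** for every `k`: twice the printed (1.67) upper bound `⟨B,Δ_kB⟩ ≤ γ₁⟨∂₁B,∂₁B⟩` (tree `ineq167_upper`). [folklore] -/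
theorem effAction_le_curlBound (k : ℕ) : (curlBound M - effAction Lc M k).PosSemidef := by
  refine posSemidef_of_isHermitian_re_nonneg ((curlBound_isHermitian M).sub (effAction_isHermitian Lc M k)) fun B => ?_
  rw [sub_mulVec, dotProduct_sub, Complex.sub_re, curlBound, smul_mulVec, dotProduct_smul, quad_curlMat, smul_eq_mul, ← Complex.ofReal_mul,
    Complex.ofReal_re, effAction_quad_eq_two_DelK Lc M k 1 one_pos, Complex.mul_re]
  have h := ineq167_upper (Lc ^ k) (one_le_pow_Lc Lc k) M 1 one_pos B
  rw [d1Sq_eq_half_curlEnergy] at h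
  simp only [Complex.re_ofNat, Complex.im_ofNat, zero_mul, sub_zero]
  nlinarith [h]

/-! ## §2 The limit form `effInf = lim_k effAction k` (`= 2Δ_∞`) -/

/-- The effective actions converge entrywise (monotone by `effAction_step_mono`, bounded by §1). [folklore] -/
theorem exists_effInf : ∃ Einf : Matrix (Tor M × Fin d) (Tor M × Fin d) ℂ, ∀ a b, Tendsto (fun k => effAction Lc M k a b) atTop (𝓝 (Einf a b)) :=
  exists_tendsto_of_mono_bounded (effAction_step_mono Lc M) (effAction_le_curlBound Lc M)

/-- **THE LIMIT EFFECTIVE ACTION `effInf := lim_k effAction k`** (twice the limit block action `Δ_∞`). [folklore] -/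
def effInf : Matrix (Tor M × Fin d) (Tor M × Fin d) ℂ := Classical.choose (exists_effInf Lc M)

/-- `effAction k → effInf` entrywise. [folklore] -/
theorem effInf_tendsto (a b : Tor M × Fin d) : Tendsto (fun k => effAction Lc M k a b) atTop (𝓝 (effInf Lc M a b)) :=
  Classical.choose_spec (exists_effInf Lc M) a b

/-- `effInf` is positive semidefinite. [folklore] -/
theorem effInf_posSemidef : (effInf Lc M).PosSemidef := posSemidef_of_tendsto (effAction_posSemidef Lc M) (effInf_tendsto Lc M)

/-- `effAction k ≤ effInf` for every `k`. [folklore] -/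
theorem effAction_le_effInf (k : ℕ) : (effInf Lc M - effAction Lc M k).PosSemidef :=
  posSemidef_limit_sub (effAction_step_mono Lc M) (effInf_tendsto Lc M) k

/-- **`Δ_{Lc^k} → Δ_∞ := ½·effInf` ENTRYWISE** — Bałaban's block actions along the scales converge (monotonically, in the Loewner order) to a limit form. [folklore] -/
theorem DelK_tendsto_half_effInf (a : ℝ) (ha : 0 < a) (x y : Tor M × Fin d) :
    Tendsto (fun k => DelK (Lc ^ k) (one_le_pow_Lc Lc k) M a ha x y) atTop (𝓝 ((2 : ℂ)⁻¹ * effInf Lc M x y)) := by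
  have h := (effInf_tendsto Lc M x y).const_mul (2 : ℂ)⁻¹
  refine h.congr fun k => ?_
  rw [effAction_eq_two_smul_DelK Lc M k a ha, Matrix.smul_apply, smul_eq_mul, ← mul_assoc, inv_mul_cancel₀ two_ne_zero, one_mul]

/-! ## §3 Kernel stability: the constrained zero modes are the closed 1-forms at every level -/

variable {c : Type*} [Fintype c] [DecidableEq c]

/-- **KERNEL STABILITY**: a zero mode of `effAction 0` (a curl-free 1-form: gradient + constant by the discrete Poincaré lemma) is a zero mode of EVERY
`effAction k` (`Δ_k` kills gradients and constants — tree `DelK_mulVec_grad`, `DelK_mulVec_const`). [folklore] -/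
theorem effAction_ker_stable (k : ℕ) (z : Tor M × Fin d → ℂ) (hz : effAction Lc M 0 *ᵥ z = 0) : effAction Lc M k *ᵥ z = 0 := by
  classical
  have hcurl := curlMat_of_effAction_ker Lc M 0 hz
  have hplaq : ∀ μ ν x, plaq M z μ ν x = 0 := fun μ ν x => by rw [← curlMat_mulVec]; rw [hcurl]; rfl
  obtain ⟨lam, h, hdec⟩ := exists_potential_of_plaq_eq_zero M z hplaq
  have hzeq : z = GradOp M 1 *ᵥ lam + fun b => h b.2 := by
    funext b
    obtain ⟨x, μ⟩ := b
    rw [Pi.add_apply, GradOp_mulVec, sdiff_mulVec, one_mul, hdec]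
  rw [effAction_eq_two_smul_DelK Lc M k 1 one_pos, smul_mulVec, hzeq, mulVec_add, DelK_mulVec_grad, DelK_mulVec_const, add_zero, smul_zero]

/-! ## §4 The plaquette covariances converge to the constrained plaquette covariance of the limit form -/

/-- **`plaqCov R k → curlMat · critCov effInf R · curlMatᴴ` ENTRYWISE** — the refinement limit of road P4's plaquette covariances is the `R`-constrained
plaquette covariance of the limit block action `effInf = 2Δ_∞` (abstract `MonotoneCovLimit.readOut_critCov_tendsto` + §1–§3). [folklore] -/
theorem plaqCov_tendsto_effInf (R : Matrix c (Tor M × Fin d) ℂ) (a b : Fin d × Fin d × Tor M) :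
    Tendsto (fun k => plaqCov Lc M R k a b) atTop
      (𝓝 ((curlMat M * critCov (effInf_posSemidef Lc M).isHermitian R * (curlMat M)ᴴ) a b)) := by
  have h := readOut_critCov_tendsto (effAction_posSemidef Lc M) (effAction_step_mono Lc M) (effInf_tendsto Lc M)
    (fun k z _ hz => effAction_ker_stable Lc M k z hz) (Q := R) (curlMat M) (fun z _ hz => curlMat_of_effAction_ker Lc M 0 hz) a b
  refine (h.congr fun k => ?_)
  rw [plaqCov_eq_critCov_effAction]

/-- **THE ONE-DATUM BAND, CENTRED AT THE IDENTIFIED LIMIT**: ONE trace datum `re tr (plaqCov R k₀ − plaqCov R j) ≤ η₀` (`j ≥ k₀`) gives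
`‖(plaqCov R j − curlMat·critCov effInf R·curlMatᴴ) a b‖ ≤ η₀` for all `j ≥ k₀` — (MONO-K) of road P4 with the limit NAMED; no rate. [folklore] -/
theorem plaqCov_sub_effInf_le (R : Matrix c (Tor M × Fin d) ℂ) {k₀ : ℕ} {η₀ : ℝ}
    (hdat : ∀ j, k₀ ≤ j → (plaqCov Lc M R k₀ - plaqCov Lc M R j).trace.re ≤ η₀) :
    ∀ j, k₀ ≤ j → ∀ a b, ‖(plaqCov Lc M R j - curlMat M * critCov (effInf_posSemidef Lc M).isHermitian R * (curlMat M)ᴴ) a b‖ ≤ η₀ :=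
  norm_sub_lim_apply_le_of_steps (fun j _ => plaqCov_antitone_step Lc M R j) hdat (plaqCov_tendsto_effInf Lc M R)

/-! ## §5 (v1.1, append-only) The FORM of the limit: `⟨B, effInf B⟩ = 2·lim_k formDk (Lc^k) M B` — the printed (1.66) forms' limit -/

/-- **THE QUADRATIC FORM OF THE LIMIT ACTION IS THE LIMIT OF THE PRINTED (1.66) FORMS**: `formDk (Lc^k) M B → ½·re⟨B, effInf B⟩` — so `Δ_∞ = ½·effInf`
is the Hermitian matrix whose form is `lim_k ⟨B, Δ_{Lc^k}B⟩` (by `effAction_quad_eq_two_formDk` = the tree's (1.65)↔(1.66) junction, termwise). [folklore] -/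
theorem formDk_tendsto_half_effInf (B : Tor M × Fin d → ℂ) :
    Tendsto (fun k => B5Bounds167Lattice.formDk (Lc ^ k) M B) atTop (𝓝 ((star B ⬝ᵥ (effInf Lc M *ᵥ B)).re / 2)) := by
  have h := ((Complex.continuous_re.tendsto _).comp (MonotoneCovLimit.tendsto_pairing (effInf_tendsto Lc M) B B)).div_const 2
  refine h.congr fun k => ?_
  simp only [Function.comp_apply, MonotoneTorusEffective.effAction_quad_eq_two_formDk, Complex.ofReal_re]
  ring

/-- **JUNCTION WITH THE TREE's LIMIT `F_∞`** (`B5ActionRate166.formDk_limit`, stated there for `Lc ≥ 2`): its limit value IS `½·re⟨B, effInf B⟩` — road P4's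
limit block action `Δ_∞` has the form `F_∞` of the b05∕asym1 lineages (uniqueness of limits; their RATE is not used or restated here). [folklore] -/
theorem half_effInf_quad_eq_formDk_limit (B : Tor M × Fin d → ℂ) {Finf : ℝ}
    (hF : Tendsto (fun k => B5Bounds167Lattice.formDk (Lc ^ k) M B) atTop (𝓝 Finf)) :
    (star B ⬝ᵥ (effInf Lc M *ᵥ B)).re / 2 = Finf :=
  tendsto_nhds_unique (formDk_tendsto_half_effInf Lc M B) hF

/-! ## §6 (v1.2, append-only) The zero modes of the limit form are those of every level -/

/-- A zero mode of `effAction 0` is a zero mode of the LIMIT form `effInf` (kernel stability §3 at every `k`, then the entrywise limit). [folklore] -/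
theorem effInf_ker_stable (z : Tor M × Fin d → ℂ) (hz : effAction Lc M 0 *ᵥ z = 0) : effInf Lc M *ᵥ z = 0 := by
  funext a
  have h := MonotoneCovLimit.tendsto_mulVec_apply (effInf_tendsto Lc M) z a
  have h0 : Tendsto (fun k => (effAction Lc M k *ᵥ z) a) atTop (𝓝 0) :=
    tendsto_const_nhds.congr fun k => by rw [effAction_ker_stable Lc M k z hz]; rfl
  exact tendsto_nhds_unique h h0

/-- **`effInf z = 0 ↔ effAction 0 z = 0`**: the limit block action `Δ_∞ = ½·effInf` and the level-0 action (hence, by `effAction_ker_iff`, EVERY `Δ_k`)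
have the SAME zero modes — the closed 1-forms (§3); the converse direction is `effAction 0 ≤ effInf` (`MonotoneTorusSoft.ker_of_ker_larger`). [folklore] -/
theorem effInf_ker_iff (z : Tor M × Fin d → ℂ) : effInf Lc M *ᵥ z = 0 ↔ effAction Lc M 0 *ᵥ z = 0 :=
  ⟨fun hz => MonotoneTorusSoft.ker_of_ker_larger (effAction_posSemidef Lc M 0) (effAction_le_effInf Lc M 0) hz, effInf_ker_stable Lc M z⟩

/-- `effAction k z = 0 ↔ effAction 0 z = 0` for every `k` (§3 and `effAction 0 ≤ effAction k`). [folklore] -/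
theorem effAction_ker_iff (k : ℕ) (z : Tor M × Fin d → ℂ) : effAction Lc M k *ᵥ z = 0 ↔ effAction Lc M 0 *ᵥ z = 0 :=
  ⟨fun hz => MonotoneTorusSoft.ker_of_ker_larger (effAction_posSemidef Lc M 0)
    (MonotoneCovLimit.posSemidef_sub_of_mono (effAction_step_mono Lc M) (Nat.zero_le k)) hz, effAction_ker_stable Lc M k z⟩

end Summit.QuantumFields.BalabanUV.Beta.GAN24.MonotoneTorusEffectiveLimit
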